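import Summits.QuantumFields.YangMills.Theorems.BalabanUVNodesN27AtTermDatumTowers13CoPHOn
import Summits.QuantumFields.YangMills.Theorems.BalabanUVNodesN27AtRecord13CoPHHolder

/-!
# BalabanUVNodes ∕ N27 = binder B5 AT THE RECORD — THE R-β TWIN of `…N27AtTermDatumTowers13CoPHOn` (p564200): N27 AT THE REGIME RECORD CLASS, ANY `Rg`, AT THE ADMISSIBLE `CoPH` READING ON THE
# RUN TOWERS GENERATED BY W1's (2.14) TERM DATA, N18 IN THE MOST LOCATED CURRENCY IN THE TREE (THE END's DATA + NODE A's LOCATED INPUTS PER TERM), NODE N16 IN ITS CURRENCY OF RECORD R-β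
# (`InEndRegimeH ∧ LeafSlotHolderAT … β`, `0 ≤ β ≤ 1`; plan g77 YMPLAN-G77-N16-PICK ∕ director-ym №195 (4)) — plan's W-SEAT-START-LIST § n27 (W-b) «(I)(I′) TermDatumTowers» twin, ONE theorem
# (cell `pub-ymgap`, HUMAN RULING D-0062 Track A ∕ D-0149 width seats; WIDTH SEAT `pub-ymgap-dag-n22-w3` released to row n27 per § n27 «w1 + released seats»; K3⁷ `SpineGivenEndpointR13SepCoPH`
# = stmt-QuantumFields-20544, `--kind proof --supports 20544 --as helper`; COUNT-NEUTRAL; `N`-generic, regime-generic, NO Theses import, 0 `def`, 0 `sorry`)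

THE READING (as in the parent).  `readingOfRecord₁₃CoPH (fun F θ ↦ ReadingData.ofRecordAdm F θ.τ9.M N (runTowers fun k ↦ toClusterTower (𝔇 F θ k).Gn₀) (sp F θ) (gauge F θ) (hg F θ) (T₀ F θ) (hT₀ F θ) (li F θ)) ℓ₃ ne2 ne1`
— term data `𝔇 F θ k`, tables `sp ⊆ big`, gauges, transports with clause `hT₀`, letters `li`, coupling domains `Dc F θ`: PARAMETERS.

WHAT IS KERNEL-CHECKED ([bookkeeping]; ONE theorem = ONE application of dag-n27-c (Q) §2 `spine_rec13CCoPHOn_at_readingOfRecord₁₃CoPH_holder` (p581033) with: dag-n18-d's regime term-data row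
`s_N18_rRec₁₃CoPHOn_readingAdm_runTowers_Gn₀_of_inputs226Holo_pin` in the N18 slot VERBATIM (as in the parent), dag-n22-e 8a″'s regime STRIP edge eliminating N22 given N18, dag-n16-e 39ᴴ
`s_N16Holder_readingOfRecord₁₃CoPHOn_of_leafSlotHolderAT hβ0 hβ1` in the N16 slot, N17 eliminated inside (Q) by dag-n17-a `s_N17_of_D4_N18`):
* `spine_rec13CCoPHOn_at_termDatumTowers₁₃CoPH_holder` — the parent's `spine_rec13CCoPHOn_at_termDatumTowers₁₃CoPH` with EXACTLY two hypothesis changes: `h16` reads `InEndRegimeH … ∧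
  LeafSlotHolderAT … β` (was `InEndRegime ∧ LeafSlotAT`), `h19` (the N19′ edge) reads `RatesHolderAt … β` (was `RatesAt`); binders `hβ0 : 0 ≤ β`, `hβ1 : β ≤ 1` added; every other hypothesis
  token-identical ⇒ `Spine (IsRecordOfRecord₁₃CCoPHOn Rg)`.  At `Rg := Node00.unityNondeg₁₃H 2`, `N = 2` the item face is leaf E ∕ F's pattern (dag-n27-c lineage; not typed here — the composer pen's).

HONEST FRAMING.  COMPOSITE-node bookkeeping BY NAME: THE END's data, NODE A's located input records, the numerals, (J) ∕ STRIP-(1.18), NE1′, NE2, `InEndRegimeH ∧ LeafSlotHolderAT β`, (D4),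
NE7b, NE7c, the extraction clause and NE7's core edge at exponent β are DISPLAYED hypotheses with no producer at the ₁₃ reading today (0∕1); the term data and every table ∕ record ∕ letter are
PARAMETERS (no Bałaban (2.14)–(2.26) datum is constructed here); nothing of Bałaban's asserted or instantiated; NE3 at exponent β NOT PROVED; no `Provisos₁₃CoPH` inhabitant claimed (K0⁷
stmt-QuantumFields-20541 OPEN); N16 ∕ N18 ∕ N22 ∕ N27 NOT discharged; K3⁷ NOT claimed; no count claim (the chair's count line is the only count; typed 28∕28 · discharged 5∕27, A 5∕28
UNMOVED); one finite four-torus programme at fixed `ε` — R4 closes the CONDITIONAL rung `BalabanLadder.UV` only; the Yang–Mills mass gap (Clay) is NOT proved by any of this; NOT ℝ⁴, NOT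
infinite volume, NOT OS, NOT a mass gap.  General-`N`.  No decl below carries a cite tag.
-/

noncomputable section

namespace Summit.QuantumFields.YangMills.Theorems.BalabanUVNodesN27SpineRecord

open Set Metric
open scoped Matrix.Norms.L2Operator

open Literature.MathematicalPhysics.QuantumFieldTheory.Balaban1983to89
open Literature.MathematicalPhysics.QuantumFieldTheory.Balaban1983to89.T4Continuum
open Literature.MathematicalPhysics.QuantumFieldTheory.Balaban1983to89.T4OutputRate (Carriers Functional NE5 DecayBound Window)
open Literature.MathematicalPhysics.QuantumFieldTheory.Balaban1983to89.TreeLengthTorus (TDom tsys torusTreeLen)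
open Literature.MathematicalPhysics.QuantumFieldTheory.Balaban1983to89.T4InputCauchyRateData (StepModel)
open Literature.MathematicalPhysics.QuantumFieldTheory.Balaban1983to89.B13Resummation (locE)
open Literature.MathematicalPhysics.QuantumFieldTheory.Balaban1983to89.TreeLengthTorusGeometry (TTouch)
open Literature.MathematicalPhysics.QuantumFieldTheory.Balaban1983to89.B12TreeDecay (K₀)
open Summit.QuantumFields.BalabanUV.T4Continuum.Spine.NE5
open YMDAG.N18.HLayer
open YMDAG.N18.W1Reading (s_N18_rRec₁₃CoPH_readingAdm_runTowers_Gn₀_of_inputs226Holo_pin s_N18_rRec₁₃CoPHOn_readingAdm_runTowers_Gn₀_of_inputs226Holo_pin n18At_u3OfRecord₁₃_readingAdm_iff)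
open T4ContinuumYM4Torus (ForSmallCouplings)
open Summit.QuantumFields.BalabanUV.T4Continuum.Spine
open YMDAG.UVSplit
open Node00 (Stage13HParams datumOfRecord₁₃CoPH IsRecordOfRecord₁₃CCoPH IsDatumOfRecord₁₃CCoPH NE3Letters₁₁ NE2Objects₁₁ ne3ConstLayerOfRecord₁₁ MatA ιSU prependCoupling)
open Node00.Sect2 (domCount domSys CPair ofBackgroundC)
open Node00.W1 (ReadingData LevelPairing LetterInputs ClusterTower pairOfRecord functionalC termC box SpRestr AdmBg)
open YMDAG.N22 (s_N22_readingOfRecord₁₃CoPH_ofRecordAdm_of_s_N18_analytic s_N22_readingOfRecord₁₃CoPHOn_ofRecordAdm_of_s_N18_stripBound)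
open Summit.QuantumFields.YangMills.BalabanUVNodes.N16Regime (InEndRegime)
open Summit.QuantumFields.YangMills.BalabanUVNodes.N16LeafSlotAllTorus (LeafSlotAT)
open Summit.QuantumFields.YangMills.BalabanUVNodes.N16AtRRec13CoPHLeafSlotAT (s_N16Holder_readingOfRecord₁₃CoPHOn_of_leafSlotHolderAT)
open Summit.QuantumFields.YangMills.BalabanUVNodes.N16HolderRegime (InEndRegimeH)
open Summit.QuantumFields.YangMills.BalabanUVNodes.N16LeafSlotAllTorus (LeafSlotHolderAT)
open Summit.QuantumFields.YangMills.BalabanUVNodes.SpineRatesHolder (RatesHolderAt)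
open Literature.MathematicalPhysics.QuantumFieldTheory.Balaban1983to89.TreeLengthTorus (TPt)
open Literature.MathematicalPhysics.QuantumFieldTheory.Balaban1983to89.B13Lemma3TorusTerms (terms)
open Literature.MathematicalPhysics.QuantumFieldTheory.Balaban1983to89.B9Thm37GlueTorus (tdist1)
open Literature.MathematicalPhysics.QuantumFieldTheory.Balaban1983to89.B13Lemma3TorusSocket (Lemma3Numerics)
open Node00.W1 (TermData214 runTowers toClusterTower OlderTerms)
open scoped BigOperators Matrix

variable {N : ℕ} [NeZero N] (cr : SpineReading₁₃CoPH N)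
  {c₀ : (F : T4Family) → Stage13HParams F N → ℕ → B13.Consts} (c : (F : T4Family) → Stage13HParams F N → ℕ → B13.Consts)
  (L : (F : T4Family) → Stage13HParams F N → ℕ → ℕ) [hL : ∀ (F : T4Family) (θ : Stage13HParams F N) (k : ℕ), NeZero (L F θ k)]
  (𝔇 : (F : T4Family) → (θ : Stage13HParams F N) → (k : ℕ) → TermData214 (c₀ F θ k) (F.P k) (MatA N) θ.τ9.M (L F θ k))
  (Dc : (F : T4Family) → Stage13HParams F N → Set ℂ)
  (sp big : (F : T4Family) → (θ : Stage13HParams F N) → (k j : ℕ) → (domSys (F.P k) θ.τ9.M j).Dom → Set (CPair (F.P k) (MatA N)))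
  (gauge : (F : T4Family) → (θ : Stage13HParams F N) → (k : ℕ) → GaugeField (F.P k) 0 (Node00.SU N) → GaugeField (F.P k) 0 (Node00.SU N) → ℝ)
  (hg : ∀ (F : T4Family) (θ : Stage13HParams F N) (k : ℕ) (U U' : GaugeField (F.P k) 0 (Node00.SU N)), 0 ≤ gauge F θ k U U')
  (T₀ : (F : T4Family) → (θ : Stage13HParams F N) → (k : ℕ) → GaugeField (F.P (k + 1)) 0 (Node00.SU N) → GaugeField (F.P k) 0 (Node00.SU N))
  (hT₀ : ∀ (F : T4Family) (θ : Stage13HParams F N) (k : ℕ) (U : GaugeField (F.P (k + 1)) 0 (Node00.SU N)),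
    (∀ (j : ℕ) (Y : (domSys (F.P (k + 1)) θ.τ9.M j).Dom), ofBackgroundC (ιSU N) U ∈ sp F θ (k + 1) j Y) →
      ∀ (j : ℕ) (X : (domSys (F.P k) θ.τ9.M j).Dom), ofBackgroundC (ιSU N) (T₀ F θ k U) ∈ sp F θ k j X)
  (li : (F : T4Family) → Stage13HParams F N → LetterInputs) (ℓ₃ : T4Family → NE3Letters₁₁)
  (ne2 : (F : T4Family) → Stage13HParams F N → (ℕ → ℝ) → List (ULoop F) → ℕ → NE2Objects₁₁)
  (ne1 : (F : T4Family) → Stage13HParams F N → (ℕ → ℝ) → List (ULoop F) → NE1pCarriers)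

variable (Rg : (F : T4Family) → Stage13HParams F N → Prop) {β : ℝ}

/-! ## The regime-restricted home, any regime `Rg`, node N16 at exponent `β` — the parent's slots, `h16` ∕ `h19` in the R-β currency -/

open Classical in
/-- ★ **N27 = B5 AT THE REGIME RECORD CLASS `IsRecordOfRecord₁₃CCoPHOn F N Rg` AT THE ADMISSIBLE READING ON THE TERM-DATA GENERATED RUN TOWERS, ANY `Rg`, NODE N16 AT EXPONENT `β`** —
the R-β twin of the parent's `spine_rec13CCoPHOn_at_termDatumTowers₁₃CoPH`: N17 ∕ N22 ELIMINATED, N18 FROM THE END's DATA AND NODE A's LOCATED INPUTS (dag-n18-d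
`s_N18_rRec₁₃CoPHOn_readingAdm_runTowers_Gn₀_of_inputs226Holo_pin`, VERBATIM), N22 ⟸ that N18 by dag-n22-e 8a″'s regime STRIP edge, NE1′ ∕ NE2 at θ in the regime, N16 as `InEndRegimeH ∧
LeafSlotHolderAT … β` once per guarded family (dag-n16-e 39ᴴ, `0 ≤ β ≤ 1`), (D4) at θ, spine side with the N19′ edge reading `RatesHolderAt … β` — ONE application of dag-n27-c (Q) §2
`spine_rec13CCoPHOn_at_readingOfRecord₁₃CoPH_holder`.  Every hypothesis 0∕1 today; NE3 at exponent β NOT PROVED. [bookkeeping] -/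
theorem spine_rec13CCoPHOn_at_termDatumTowers₁₃CoPH_holder (hβ0 : 0 ≤ β) (hβ1 : β ≤ 1)
    (h14 : ∀ (F : T4Family) (θ : Stage13HParams F N), θ.Provisos₁₃CoPH F N → Rg F θ → θ.Admissible F N → ∀ (g₀ : ℕ → ℝ) (os : List (ULoop F)),
      N14At (ne1 F θ g₀ os))
    (h15 : ∀ (F : T4Family) (θ : Stage13HParams F N), θ.Provisos₁₃CoPH F N → Rg F θ → θ.Admissible F N → ∀ (g₀ : ℕ → ℝ) (os : List (ULoop F)) (k : ℕ),
      N15At (ne2OfRecord₁₁ (ne2 F θ g₀ os k)))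
    (h16 : ∀ (F : T4Family), (∃ θ : Stage13HParams F N, θ.Provisos₁₃CoPH F N ∧ Rg F θ ∧ θ.Admissible F N) →
      InEndRegimeH (ne3OfRecord₁₁ F (ne3ConstLayerOfRecord₁₁ F N (ℓ₃ F))) ∧ LeafSlotHolderAT (ne3OfRecord₁₁ F (ne3ConstLayerOfRecord₁₁ F N (ℓ₃ F))) β)
    -- N18 ⟸ THE END's data + NODE A's located inputs per term, asked of the tuples IN THE REGIME (dag-n18-d `…On_readingAdm_runTowers_Gn₀_of_inputs226Holo_pin`, verbatim)
    (h18 : ∀ (F : T4Family) (θ : Stage13HParams F N), θ.Provisos₁₃CoPH F N → Rg F θ → θ.Admissible F N → ∀ [NeZero θ.τ9.M] (k : ℕ),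
      ∃ (Op : Type) (_ : NormedAddCommGroup Op) (_ : NormedSpace ℂ Op) (Hist : Type) (_ : NormedAddCommGroup Hist) (_ : NormedSpace ℂ Hist)
        (Mb : ℝ → StepModel (LevelPairing.ofRecordAdm F θ.τ9.M N k (sp F θ) (gauge F θ k) (hg F θ k) (T₀ F θ k) (hT₀ F θ k)).carriers Op Hist)
        (act : ℝ → (j : ℕ) → Op × Hist → TDom 4 (domCount (F.P k) θ.τ9.M j) → ℂ) (γ' C3 ε₁ Rd κ A_A A_B E_A E_B E₁ δ δ' θr θ' cH ω ρ₀ B : ℝ) (k₀ : ℕ)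
        (aA a₂A a₂A' a₅A AabsA aB a₂B a₂B' a₅B AabsB : ℝ),
        (∀ b : ℝ, 0 < b → b ≤ γ' → ∀ (X : Node00.W1.Dom (F.P k) θ.τ9.M) (z : Op × Hist),
          (Mb b).Out X.1 z.1 z.2 X =
            locE (TTouch (d := 4) (N := domCount (F.P k) θ.τ9.M X.1)) (fun Z : (tsys 4 (domCount (F.P k) θ.τ9.M X.1)).Dom => Z.1)
              (act b X.1 z) X.2.1) ∧
        0 ≤ C3 ∧ 0 ≤ ε₁ ∧ 0 ≤ κ ∧ κ + 2 * (64 * Real.log 162) + 2 ≤ Rd ∧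
        C3 * ε₁ * Real.exp (5 * κ + 1) * K₀ 64 8 * 9 * 64 ≤ 1 ∧
        (∀ b : ℝ, 0 < b → b ≤ γ' → ∀ j, ∀ g ∈ Window γ',
          ∀ (U : (LevelPairing.ofRecordAdm F θ.τ9.M N k (sp F θ) (gauge F θ k) (hg F θ k) (T₀ F θ k) (hT₀ F θ k)).BgB) (q : Op × Hist), q ∈ (Mb b).Base j g U →
          ∃ V : Set (Op × Hist), IsOpen V ∧ (Mb b).box j q ⊆ V ∧
            (∀ Z : TDom 4 (domCount (F.P k) θ.τ9.M j), DifferentiableOn ℂ (fun z : Op × Hist => act b j z Z) V) ∧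
            (∀ z ∈ V, ∀ Z : TDom 4 (domCount (F.P k) θ.τ9.M j), ‖act b j z Z‖ ≤ C3 * ε₁ * Real.exp (-(Rd * torusTreeLen Z.1)))) ∧
        (∀ b : ℝ, 0 < b → b ≤ γ' → L01 (Mb b)
          ((LevelPairing.ofRecordAdm F θ.τ9.M N k (sp F θ) (gauge F θ k) (hg F θ k) (T₀ F θ k) (hT₀ F θ k)).EA (runTowers (fun k => toClusterTower ((𝔇 F θ k).Gn₀)) k)) (Window γ')) ∧
        (∀ b : ℝ, 0 < b → b ≤ γ' → L02 (Mb b)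
          ((LevelPairing.ofRecordAdm F θ.τ9.M N k (sp F θ) (gauge F θ k) (hg F θ k) (T₀ F θ k) (hT₀ F θ k)).EB (runTowers (fun k => toClusterTower ((𝔇 F θ k).Gn₀)) (k + 1)) b) (Window γ')) ∧
        (∀ b : ℝ, 0 < b → b ≤ γ' → L03 (Mb b)
          ((LevelPairing.ofRecordAdm F θ.τ9.M N k (sp F θ) (gauge F θ k) (hg F θ k) (T₀ F θ k) (hT₀ F θ k)).EB (runTowers (fun k => toClusterTower ((𝔇 F θ k).Gn₀)) (k + 1)) b) (Window γ')) ∧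
        (∀ b : ℝ, 0 < b → b ≤ γ' → L07 (Mb b) (Window γ') δ θr) ∧
        (∀ b : ℝ, 0 < b → b ≤ γ' → L08 (Mb b) (Window γ') κ (Real.exp 1 * 9 * 64 * K₀ 64 8 ^ 2 * A_B) δ' θr) ∧
        (∀ b : ℝ, 0 < b → b ≤ γ' → L09aff (Mb b) (Window γ')) ∧ (∀ b : ℝ, 0 < b → b ≤ γ' → L09blind (Mb b) (Window γ')) ∧
        (∀ b : ℝ, 0 < b → b ≤ γ' → L09hom (Mb b) (Window γ')) ∧ (∀ b : ℝ, 0 < b → b ≤ γ' → L09unit (Mb b) (Window γ') κ E₁ cH ω) ∧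
        0 < E₁ ∧ 0 ≤ δ + δ' ∧ 0 ≤ θr ∧ θr ≤ θ' ∧ θ' ≤ 1 ∧ 0 ≤ cH ∧ 0 < ω ∧ ρ₀ < 1 ∧
        (δ + δ') * θr ^ k₀ +
            cH * (Real.exp 1 * 9 * 64 * K₀ 64 8 ^ 2 * A_A + Real.exp 1 * 9 * 64 * K₀ 64 8 ^ 2 * A_B) / (1 - ω) ≤ ρ₀ ∧
        0 ≤ B ∧ (∀ k < k₀, Real.exp 1 * 9 * 64 * K₀ 64 8 ^ 2 * A_A + Real.exp 1 * 9 * 64 * K₀ 64 8 ^ 2 * A_B ≤ B * θr ^ k) ∧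
        Real.exp 1 * 9 * 64 * K₀ 64 8 ^ 2 * C3 * cH * ε₁ < (θ' - ω) * (1 - ρ₀) ∧
        (∀ m, SpRestr (sp F θ k (m + 1))) ∧
        (∀ (m : ℕ) (Z : (domSys (F.P k) θ.τ9.M (m + 1)).Dom), IsOpen (big F θ k (m + 1) Z)) ∧
        (∀ (m : ℕ) (Z : (domSys (F.P k) θ.τ9.M (m + 1)).Dom), sp F θ k (m + 1) Z ⊆ big F θ k (m + 1) Z) ∧
        1 ≤ (c F θ k).κ₁ ∧ (c F θ k).α₆ ≠ 0 ∧ 8 ≤ (c F θ k).L ∧ (c F θ k).L = L F θ k ∧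
        Lemma3Numerics (c F θ k) θ.τ9.M (((c F θ k).L : ℝ) / 2) aA a₂A a₂A' a₅A AabsA ∧
        (∀ m : ℕ, ∀ s ∈ Dc F θ, ∀ old : OlderTerms (F.P k) (MatA N) θ.τ9.M m,
          (∀ (j : Fin (m + 1)) (Y : (domSys (F.P k) θ.τ9.M j).Dom), ∀ ψ ∈ sp F θ k j Y, ‖old j Y ψ‖ ≤ E_A * Real.exp (-(κ * (domSys (F.P k) θ.τ9.M j).dj Y))) →
          (∀ (j : Fin (m + 1)) (Y : (domSys (F.P k) θ.τ9.M j).Dom), AnalyticOnNhd ℂ (old j Y) (sp F θ k j Y)) →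
          ∀ (Z : (domSys (F.P k) θ.τ9.M (m + 1)).Dom), ∀ t ∈ terms (L F θ k) θ.τ9.M Z, ∀ φ₁ ∈ big F θ k (m + 1) Z,
            ∃ ι : (𝔇 F θ k m).Inputs226Holo (c F θ k) Z t s old φ₁ aA a₅A,
            (∀ φ ∈ big F θ k (m + 1) Z, ∀ i j, DifferentiableOn ℂ (fun σ => (𝔇 F θ k m).A Z t φ σ i j) {σ | ∀ j, σ j ∈ ι.Uσ}) ∧
            (∀ φ ∈ big F θ k (m + 1) Z, ∀ i j, DifferentiableOn ℂ (fun σ => ((𝔇 F θ k m).𝒦 Z t).G2 σ ((𝔇 F θ k m).uOf Z t φ) i j) {σ | ∀ j, σ j ∈ ι.Uσ}) ∧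
            (∀ σ : TPt (F.P k).d (domCount (F.P k) θ.τ9.M (m + 1)) → ℂ, (∀ j, σ j ∈ ι.Uσ) →
              ∀ i j, DifferentiableOn ℂ (fun φ => (𝔇 F θ k m).A Z t φ σ i j) (big F θ k (m + 1) Z)) ∧
            (∀ σ : TPt (F.P k).d (domCount (F.P k) θ.τ9.M (m + 1)) → ℂ, (∀ j, σ j ∈ ι.Uσ) →
              ∀ i j, DifferentiableOn ℂ (fun φ => ((𝔇 F θ k m).𝒦 Z t).G2 σ ((𝔇 F θ k m).uOf Z t φ) i j) (big F θ k (m + 1) Z)) ∧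
            (∀ Y B, DifferentiableOn ℂ (fun φ => (𝔇 F θ k m).𝒱 Z t s old φ Y B) (big F θ k (m + 1) Z)) ∧
            (∀ φ ∈ big F θ k (m + 1) Z, ∀ Y, Measurable ((𝔇 F θ k m).𝒱 Z t s old φ Y)) ∧
            (∀ φ ∈ big F θ k (m + 1) Z, ∀ σ : TPt (F.P k).d (domCount (F.P k) θ.τ9.M (m + 1)) → ℂ, (∀ j, σ j ∈ ι.Uσ) → ((𝔇 F θ k m).A Z t φ σ).IsSymm) ∧
            (∀ φ ∈ big F θ k (m + 1) Z, ∀ σ : TPt (F.P k).d (domCount (F.P k) θ.τ9.M (m + 1)) → ℂ, (∀ j, σ j ∈ ι.Uσ) →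
              (((𝔇 F θ k m).A Z t φ σ).map Complex.re).PosDef) ∧
            (∀ φ ∈ big F θ k (m + 1) Z, ∀ τ : TDom (F.P k).d ((L F θ k) * domCount (F.P k) θ.τ9.M (m + 1)) → ℂ, (∀ Y, τ Y ∈ ι.Uτ Y) →
              ∀ B, ∑ Y ∈ t.1, ‖τ Y‖ * ‖(𝔇 F θ k m).𝒱 Z t s old φ Y B‖ ≤ ι.a₂₀ / 2 * (B ⬝ᵥ B) + ι.w) ∧
            (∀ φ ∈ big F θ k (m + 1) Z, ∀ σ : TPt (F.P k).d (domCount (F.P k) θ.τ9.M (m + 1)) → ℂ, (∀ j, σ j ∈ ι.Uσ) →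
              ∀ b j, ‖((𝔇 F θ k m).𝒦 Z t).G2 σ ((𝔇 F θ k m).uOf Z t φ) b j‖ ≤
                ι.KG * Real.exp (-(ι.kap * tdist1 (𝔇 F θ k m).Nf (((𝔇 F θ k m).𝒦 Z t).locΛ b) (((𝔇 F θ k m).𝒦 Z t).locN j)))) ∧
            (∀ φ ∈ big F θ k (m + 1) Z, ∀ σ : TPt (F.P k).d (domCount (F.P k) θ.τ9.M (m + 1)) → ℂ, (∀ j, σ j ∈ ι.Uσ) →
              ∀ b b', ‖((𝔇 F θ k m).A Z t φ σ)⁻¹ b b'‖ ≤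
                ι.KCs * Real.exp (-(ι.kap * tdist1 (𝔇 F θ k m).Nf (((𝔇 F θ k m).𝒦 Z t).locΛ b) (((𝔇 F θ k m).𝒦 Z t).locΛ b')))) ∧
            (∀ φ ∈ big F θ k (m + 1) Z, ∀ σ : TPt (F.P k).d (domCount (F.P k) θ.τ9.M (m + 1)) → ℂ, (∀ j, σ j ∈ ι.Uσ) →
              ∀ b j, ‖(((𝔇 F θ k m).𝒦 Z t).G2 σ ((𝔇 F θ k m).uOf Z t φ) - ((𝔇 F θ k m).𝒦 Z t).Γ₀.map (algebraMap ℝ ℂ)) b j‖ ≤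
                ι.θΓ * Real.exp (-(ι.kap * tdist1 (𝔇 F θ k m).Nf (((𝔇 F θ k m).𝒦 Z t).locΛ b) (((𝔇 F θ k m).𝒦 Z t).locN j)))) ∧
            (∀ φ ∈ big F θ k (m + 1) Z, ∀ σ : TPt (F.P k).d (domCount (F.P k) θ.τ9.M (m + 1)) → ℂ, (∀ j, σ j ∈ ι.Uσ) →
              ∀ b b', ‖(((𝔇 F θ k m).A Z t φ σ)⁻¹ - ((𝔇 F θ k m).𝒦 Z t).C.map (algebraMap ℝ ℂ)) b b'‖ ≤
                ι.θC * Real.exp (-(ι.kap * tdist1 (𝔇 F θ k m).Nf (((𝔇 F θ k m).𝒦 Z t).locΛ b) (((𝔇 F θ k m).𝒦 Z t).locΛ b')))) ∧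
            (∀ φ ∈ big F θ k (m + 1) Z, ∀ σ : TPt (F.P k).d (domCount (F.P k) θ.τ9.M (m + 1)) → ℂ, (∀ j, σ j ∈ ι.Uσ) →
              ∀ b b', ‖((𝔇 F θ k m).A Z t φ σ - ((𝔇 F θ k m).𝒦 Z t).C⁻¹.map (algebraMap ℝ ℂ)) b b'‖ ≤
                ι.θE * Real.exp (-(ι.kap * tdist1 (𝔇 F θ k m).Nf (((𝔇 F θ k m).𝒦 Z t).locΛ b) (((𝔇 F θ k m).𝒦 Z t).locΛ b'))))) ∧
        0 ≤ (c F θ k).C3act * (c F θ k).ε₁ ∧ (c F θ k).C3act * (c F θ k).ε₁ ≤ A_A ∧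
        Rd ≤ (1 - 8 * (c F θ k).δ) * (((c F θ k).L : ℝ) / 2) * (c F θ k).κ ∧
        A_A * Real.exp (5 * κ + 1) * K₀ 64 8 * 9 * 64 < 1 ∧ Real.exp 1 * 9 * 64 * K₀ 64 8 ^ 2 * A_A ≤ E_A ∧
        (∀ m, SpRestr (sp F θ (k + 1) (m + 1))) ∧
        (∀ (m : ℕ) (Z : (domSys (F.P (k + 1)) θ.τ9.M (m + 1)).Dom), IsOpen (big F θ (k + 1) (m + 1) Z)) ∧
        (∀ (m : ℕ) (Z : (domSys (F.P (k + 1)) θ.τ9.M (m + 1)).Dom), sp F θ (k + 1) (m + 1) Z ⊆ big F θ (k + 1) (m + 1) Z) ∧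
        1 ≤ (c F θ (k + 1)).κ₁ ∧ (c F θ (k + 1)).α₆ ≠ 0 ∧ 8 ≤ (c F θ (k + 1)).L ∧ (c F θ (k + 1)).L = L F θ (k + 1) ∧
        Lemma3Numerics (c F θ (k + 1)) θ.τ9.M (((c F θ (k + 1)).L : ℝ) / 2) aB a₂B a₂B' a₅B AabsB ∧
        (∀ m : ℕ, ∀ s ∈ Dc F θ, ∀ old : OlderTerms (F.P (k + 1)) (MatA N) θ.τ9.M m,
          (∀ (j : Fin (m + 1)) (Y : (domSys (F.P (k + 1)) θ.τ9.M j).Dom), ∀ ψ ∈ sp F θ (k + 1) j Y, ‖old j Y ψ‖ ≤ E_B * Real.exp (-(κ * (domSys (F.P (k + 1)) θ.τ9.M j).dj Y))) →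
          (∀ (j : Fin (m + 1)) (Y : (domSys (F.P (k + 1)) θ.τ9.M j).Dom), AnalyticOnNhd ℂ (old j Y) (sp F θ (k + 1) j Y)) →
          ∀ (Z : (domSys (F.P (k + 1)) θ.τ9.M (m + 1)).Dom), ∀ t ∈ terms (L F θ (k + 1)) θ.τ9.M Z, ∀ φ₁ ∈ big F θ (k + 1) (m + 1) Z,
            ∃ ι : (𝔇 F θ (k + 1) m).Inputs226Holo (c F θ (k + 1)) Z t s old φ₁ aB a₅B,
            (∀ φ ∈ big F θ (k + 1) (m + 1) Z, ∀ i j, DifferentiableOn ℂ (fun σ => (𝔇 F θ (k + 1) m).A Z t φ σ i j) {σ | ∀ j, σ j ∈ ι.Uσ}) ∧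
            (∀ φ ∈ big F θ (k + 1) (m + 1) Z, ∀ i j, DifferentiableOn ℂ (fun σ => ((𝔇 F θ (k + 1) m).𝒦 Z t).G2 σ ((𝔇 F θ (k + 1) m).uOf Z t φ) i j) {σ | ∀ j, σ j ∈ ι.Uσ}) ∧
            (∀ σ : TPt (F.P (k + 1)).d (domCount (F.P (k + 1)) θ.τ9.M (m + 1)) → ℂ, (∀ j, σ j ∈ ι.Uσ) →
              ∀ i j, DifferentiableOn ℂ (fun φ => (𝔇 F θ (k + 1) m).A Z t φ σ i j) (big F θ (k + 1) (m + 1) Z)) ∧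
            (∀ σ : TPt (F.P (k + 1)).d (domCount (F.P (k + 1)) θ.τ9.M (m + 1)) → ℂ, (∀ j, σ j ∈ ι.Uσ) →
              ∀ i j, DifferentiableOn ℂ (fun φ => ((𝔇 F θ (k + 1) m).𝒦 Z t).G2 σ ((𝔇 F θ (k + 1) m).uOf Z t φ) i j) (big F θ (k + 1) (m + 1) Z)) ∧
            (∀ Y B, DifferentiableOn ℂ (fun φ => (𝔇 F θ (k + 1) m).𝒱 Z t s old φ Y B) (big F θ (k + 1) (m + 1) Z)) ∧
            (∀ φ ∈ big F θ (k + 1) (m + 1) Z, ∀ Y, Measurable ((𝔇 F θ (k + 1) m).𝒱 Z t s old φ Y)) ∧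
            (∀ φ ∈ big F θ (k + 1) (m + 1) Z, ∀ σ : TPt (F.P (k + 1)).d (domCount (F.P (k + 1)) θ.τ9.M (m + 1)) → ℂ, (∀ j, σ j ∈ ι.Uσ) → ((𝔇 F θ (k + 1) m).A Z t φ σ).IsSymm) ∧
            (∀ φ ∈ big F θ (k + 1) (m + 1) Z, ∀ σ : TPt (F.P (k + 1)).d (domCount (F.P (k + 1)) θ.τ9.M (m + 1)) → ℂ, (∀ j, σ j ∈ ι.Uσ) →
              (((𝔇 F θ (k + 1) m).A Z t φ σ).map Complex.re).PosDef) ∧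
            (∀ φ ∈ big F θ (k + 1) (m + 1) Z, ∀ τ : TDom (F.P (k + 1)).d ((L F θ (k + 1)) * domCount (F.P (k + 1)) θ.τ9.M (m + 1)) → ℂ, (∀ Y, τ Y ∈ ι.Uτ Y) →
              ∀ B, ∑ Y ∈ t.1, ‖τ Y‖ * ‖(𝔇 F θ (k + 1) m).𝒱 Z t s old φ Y B‖ ≤ ι.a₂₀ / 2 * (B ⬝ᵥ B) + ι.w) ∧
            (∀ φ ∈ big F θ (k + 1) (m + 1) Z, ∀ σ : TPt (F.P (k + 1)).d (domCount (F.P (k + 1)) θ.τ9.M (m + 1)) → ℂ, (∀ j, σ j ∈ ι.Uσ) →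
              ∀ b j, ‖((𝔇 F θ (k + 1) m).𝒦 Z t).G2 σ ((𝔇 F θ (k + 1) m).uOf Z t φ) b j‖ ≤
                ι.KG * Real.exp (-(ι.kap * tdist1 (𝔇 F θ (k + 1) m).Nf (((𝔇 F θ (k + 1) m).𝒦 Z t).locΛ b) (((𝔇 F θ (k + 1) m).𝒦 Z t).locN j)))) ∧
            (∀ φ ∈ big F θ (k + 1) (m + 1) Z, ∀ σ : TPt (F.P (k + 1)).d (domCount (F.P (k + 1)) θ.τ9.M (m + 1)) → ℂ, (∀ j, σ j ∈ ι.Uσ) →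
              ∀ b b', ‖((𝔇 F θ (k + 1) m).A Z t φ σ)⁻¹ b b'‖ ≤
                ι.KCs * Real.exp (-(ι.kap * tdist1 (𝔇 F θ (k + 1) m).Nf (((𝔇 F θ (k + 1) m).𝒦 Z t).locΛ b) (((𝔇 F θ (k + 1) m).𝒦 Z t).locΛ b')))) ∧
            (∀ φ ∈ big F θ (k + 1) (m + 1) Z, ∀ σ : TPt (F.P (k + 1)).d (domCount (F.P (k + 1)) θ.τ9.M (m + 1)) → ℂ, (∀ j, σ j ∈ ι.Uσ) →
              ∀ b j, ‖(((𝔇 F θ (k + 1) m).𝒦 Z t).G2 σ ((𝔇 F θ (k + 1) m).uOf Z t φ) - ((𝔇 F θ (k + 1) m).𝒦 Z t).Γ₀.map (algebraMap ℝ ℂ)) b j‖ ≤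
                ι.θΓ * Real.exp (-(ι.kap * tdist1 (𝔇 F θ (k + 1) m).Nf (((𝔇 F θ (k + 1) m).𝒦 Z t).locΛ b) (((𝔇 F θ (k + 1) m).𝒦 Z t).locN j)))) ∧
            (∀ φ ∈ big F θ (k + 1) (m + 1) Z, ∀ σ : TPt (F.P (k + 1)).d (domCount (F.P (k + 1)) θ.τ9.M (m + 1)) → ℂ, (∀ j, σ j ∈ ι.Uσ) →
              ∀ b b', ‖(((𝔇 F θ (k + 1) m).A Z t φ σ)⁻¹ - ((𝔇 F θ (k + 1) m).𝒦 Z t).C.map (algebraMap ℝ ℂ)) b b'‖ ≤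
                ι.θC * Real.exp (-(ι.kap * tdist1 (𝔇 F θ (k + 1) m).Nf (((𝔇 F θ (k + 1) m).𝒦 Z t).locΛ b) (((𝔇 F θ (k + 1) m).𝒦 Z t).locΛ b')))) ∧
            (∀ φ ∈ big F θ (k + 1) (m + 1) Z, ∀ σ : TPt (F.P (k + 1)).d (domCount (F.P (k + 1)) θ.τ9.M (m + 1)) → ℂ, (∀ j, σ j ∈ ι.Uσ) →
              ∀ b b', ‖((𝔇 F θ (k + 1) m).A Z t φ σ - ((𝔇 F θ (k + 1) m).𝒦 Z t).C⁻¹.map (algebraMap ℝ ℂ)) b b'‖ ≤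
                ι.θE * Real.exp (-(ι.kap * tdist1 (𝔇 F θ (k + 1) m).Nf (((𝔇 F θ (k + 1) m).𝒦 Z t).locΛ b) (((𝔇 F θ (k + 1) m).𝒦 Z t).locΛ b'))))) ∧
        0 ≤ (c F θ (k + 1)).C3act * (c F θ (k + 1)).ε₁ ∧ (c F θ (k + 1)).C3act * (c F θ (k + 1)).ε₁ ≤ A_B ∧
        Rd ≤ (1 - 8 * (c F θ (k + 1)).δ) * (((c F θ (k + 1)).L : ℝ) / 2) * (c F θ (k + 1)).κ ∧
        A_B * Real.exp (5 * κ + 1) * K₀ 64 8 * 9 * 64 < 1 ∧ Real.exp 1 * 9 * 64 * K₀ 64 8 ^ 2 * A_B ≤ E_B ∧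
        (∀ s ∈ Ioc (0 : ℝ) γ', ((s : ℝ) : ℂ) ∈ Dc F θ) ∧
        θ.γ ≤ γ' ∧ (li F θ).κ ≤ κ ∧ θ' ≤ (li F θ).θ₅ ∧
        (Real.exp 1 * 9 * 64 * K₀ 64 8 ^ 2 * (C3 * ε₁) / (1 - ρ₀) * (δ + δ') + B) * (θ' - ω) /
            (θ' - (ω + Real.exp 1 * 9 * 64 * K₀ 64 8 ^ 2 * (C3 * ε₁) / (1 - ρ₀) * cH)) ≤ (li F θ).C₅)
    -- N22 ⟸ N18 (dag-n22-e module 8a″, STRIP currency on the reading's OWN table, NO readings clause): (J), twelve numerals, STRIP-(1.18) — verbatim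
    (hjunk : ∀ (F : T4Family) (θ : Stage13HParams F N), θ.Provisos₁₃CoPH F N → Rg F θ → θ.Admissible F N →
      ∀ (k : ℕ) (X : Node00.W1.Dom (F.P k) θ.τ9.M), k < X.1 → ∀ (g : ℕ → ℝ) (φ : CPair (F.P k) (MatA N)), functionalC (runTowers (fun k => toClusterTower (𝔇 F θ k).Gn₀) k) g φ X = 0)
    (hnum : ∀ (F : T4Family) (θ : Stage13HParams F N), θ.Provisos₁₃CoPH F N → Rg F θ → θ.Admissible F N →
      0 < (li F θ).C₀ ∧ 0 < (li F θ).θ₅ ∧ (li F θ).θ₅ < 1 ∧ 0 ≤ (li F θ).C₅ ∧ 2 * (li F θ).C₅ / (1 - (li F θ).θ₅) ≤ (li F θ).C₀ ∧ 0 < (li F θ).A ∧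
        (li F θ).θ₅ ≤ (li F θ).μ ∧ (li F θ).C₀ ≤ 2 * (li F θ).A ∧ 0 < (li F θ).r ∧ 0 < (li F θ).s ∧ (li F θ).s < 1 ∧ 1 ≤ (li F θ).μ)
    (hstrip : ∀ (F : T4Family) (θ : Stage13HParams F N), θ.Provisos₁₃CoPH F N → Rg F θ → θ.Admissible F N → ∀ (k : ℕ),
      ∀ (j : ℕ) (g : ℕ → ℝ), g ∈ Window θ.γ → ∀ (i : ℕ) (Y : (domSys (F.P k) θ.τ9.M j).Dom) (ψ : CPair (F.P k) (MatA N)), ψ ∈ sp F θ k j Y →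
        ∃ (Ec : ℂ → ℂ) (O : Set ℂ), IsOpen O ∧ (∀ t ∈ Ioc (0 : ℝ) θ.γ, closedBall (t : ℂ) (li F θ).r ⊆ O) ∧ DifferentiableOn ℂ Ec O ∧
          (∀ z ∈ O, ‖Ec z‖ ≤ (li F θ).A * Real.exp (-((li F θ).κ * torusTreeLen Y.1))) ∧
          (∀ t ∈ Ioc (0 : ℝ) θ.γ, Ec t = termC (runTowers (fun k => toClusterTower (𝔇 F θ k).Gn₀) k) j Y (Function.update g i t) ψ))
    (hD4 : ∀ (F : T4Family) (θ : Stage13HParams F N) (hP : θ.Provisos₁₃CoPH F N), Rg F θ → θ.Admissible F N → ∀ k : ℕ,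
      ReadOutAt (datumOfRecord₁₃CoPH F N θ hP) (u3OfRecord₁₃ θ.toStage13Params
        ((ReadingData.ofRecordAdm F θ.τ9.M N (runTowers fun k => toClusterTower (𝔇 F θ k).Gn₀) (sp F θ) (gauge F θ) (hg F θ) (T₀ F θ) (hT₀ F θ) (li F θ)).u3Objects θ.γ) k))
    (h20 : S_N20 (SRec₁₃CoPHOn cr Rg)) (h21 : S_N21 (SRec₁₃CoPHOn cr Rg))
    (hx : ∀ (F : T4Family) (θ : Stage13HParams F N) (hP : θ.Provisos₁₃CoPH F N), Rg F θ → θ.Admissible F N →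
      B16.EndStatementBPrinted (datumOfRecord₁₃CoPH F N θ hP).C → DagBinding.EndpointExistence (datumOfRecord₁₃CoPH F N θ hP).C.toB12 →
        ForSmallCouplings (datumOfRecord₁₃CoPH F N θ hP) fun g₀ => ∀ os : List (ULoop F),
          0 < (cr F θ hP g₀ os).l₀ ∧ 0 < (cr F θ hP g₀ os).vol ∧
          (∀ (K : ℕ) (t : ℝ), |t| ≤ (cr F θ hP g₀ os).l₀ →
            T4GenFunBounds.schemeZ ((datumOfRecord₁₃CoPH F N θ hP).scheme g₀) os ((cr F θ hP g₀ os).K₀ + K) t =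
              ∑ τ ∈ (cr F θ hP g₀ os).T K, (cr F θ hP g₀ os).A K t τ) ∧
          (∀ (K : ℕ) (t : ℝ), |t| ≤ (cr F θ hP g₀ os).l₀ →
            T4GenFunBounds.schemeZ ((datumOfRecord₁₃CoPH F N θ hP).scheme g₀) os ((cr F θ hP g₀ os).K₀ + K + 1) t =
              ∑ τ ∈ (cr F θ hP g₀ os).T K, (cr F θ hP g₀ os).B K t τ))
    (h19 : ∀ (F : T4Family) (θ : Stage13HParams F N) (hP : θ.Provisos₁₃CoPH F N), Rg F θ → θ.Admissible F N → ∀ (g₀ : ℕ → ℝ) (os : List (ULoop F)),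
      (∀ k : ℕ, RatesHolderAt (datumOfRecord₁₃CoPH F N θ hP) (rateCarriersOfRecord₁₃CoPH (readingOfRecord₁₃CoPH
        (fun F θ => ReadingData.ofRecordAdm F θ.τ9.M N (runTowers fun k => toClusterTower (𝔇 F θ k).Gn₀) (sp F θ) (gauge F θ) (hg F θ) (T₀ F θ) (hT₀ F θ) (li F θ)) ℓ₃ ne2 ne1) F θ hP g₀ os k) β) →
        letI := (cr F θ hP g₀ os).dec
        ∃ δ : ℕ → ℝ, NE7.Core (cr F θ hP g₀ os).l₀ (cr F θ hP g₀ os).vol (cr F θ hP g₀ os).T (cr F θ hP g₀ os).Bad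
          (fun K t τ => (cr F θ hP g₀ os).A K t τ - (cr F θ hP g₀ os).shA K t τ) (fun K t τ => (cr F θ hP g₀ os).B K t τ - (cr F θ hP g₀ os).shB K t τ) δ ∧
          Summable δ) :
    Spine (N := N) fun F D w => Node00.IsRecordOfRecord₁₃CCoPHOn F N Rg D w :=
  have h18' : S_N18 (RRec₁₃CoPHOn (readingOfRecord₁₃CoPH (fun F θ => ReadingData.ofRecordAdm F θ.τ9.M N (runTowers fun k => toClusterTower (𝔇 F θ k).Gn₀) (sp F θ) (gauge F θ) (hg F θ) (T₀ F θ) (hT₀ F θ) (li F θ)) ℓ₃ ne2 ne1) Rg) :=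
    s_N18_rRec₁₃CoPHOn_readingAdm_runTowers_Gn₀_of_inputs226Holo_pin (𝔯 := _) (Rg := Rg) (c := c) (L := L) (𝔇 := 𝔇) (D := Dc) (sp := sp) (big := big) (gauge := gauge)
      (hg := hg) (T₀ := T₀) (hT := hT₀) (li := li) (readingOfRecord₁₃CoPH_u3 _ ℓ₃ ne2 ne1) h18
  spine_rec13CCoPHOn_at_readingOfRecord₁₃CoPH_holder cr β _ ne2 ne1 Rg ℓ₃
    ((s_N14_rRec₁₃CoPHOn_iff _ Rg).mpr fun F θ hP hRg hθ g₀ os => h14 F θ hP hRg hθ g₀ os)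
    ((s_N15_rRec₁₃CoPHOn_iff _ Rg).mpr fun F θ hP hRg hθ g₀ os k => h15 F θ hP hRg hθ g₀ os k)
    (s_N16Holder_readingOfRecord₁₃CoPHOn_of_leafSlotHolderAT (Rg := Rg) (w1 := _) (ℓ₃ := ℓ₃) (ne2 := ne2) (ne1 := ne1) hβ0 hβ1 h16)
    h18' (s_N22_readingOfRecord₁₃CoPHOn_ofRecordAdm_of_s_N18_stripBound (fun F θ => runTowers fun k => toClusterTower (𝔇 F θ k).Gn₀) sp gauge hg T₀ hT₀ li ℓ₃ ne2 ne1 Rg h18' hjunk hnum hstrip)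
    ((s_D4_rRec₁₃CoPHOn_iff _ Rg).mpr fun F θ hP hRg hθ _ _ k => hD4 F θ hP hRg hθ k) h20 h21 hx h19

end Summit.QuantumFields.YangMills.Theorems.BalabanUVNodesN27SpineRecord

end
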